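import Summits.QuantumFields.YangMills.Theorems.AllWindowsColdBoxBoxHighLineFPChartWeightSandwich
import Summits.QuantumFields.YangMills.Theorems.AllWindowsColdBoxBoxHighLineChartGaussianBulk

/-!
# T-S5.6 core: the two INTEGRAL bounds behind `SmallFieldInsideFP` with explicit parameters
# (STUB-PLAN-S5-STEP2 §5 T-S5.6, planner ym-idea-2 g18; LINE-19 S5 ⟨stmt-QuantumFields-24004⟩/⟨24335⟩, LINE-20 U5 ⟨24336⟩; objects from ✓`…Step2Defs` BY NAME)

Width seat `ym-line-sfw-p2-w4` (prover-ym-line-sfw-p2-w4-g27-0), T-S5.6 holder.  Given, at a support level `T` (in T-S5.6: `T = π·r`),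
(i) an ACTION SANDWICH `|boxWilson + landauPhi − boxQuadForm| ≤ ε·boxQuadForm` on `smallField H T` (T-S5.6a at `t = T`, `0 ≤ ε ≤ 1/2`),
(ii) a two-sided DETERMINANT comparison `|det F(U_a)| ≤ K·D₀`, `D₀ ≤ K·|det F(U_a)|` on `smallField H T` (6b), and
(iii) the variance bound `(hodgeQ H)⁻¹ₑₑ ≤ C₃` (✓S3a), the Faddeev–Popov chart weight `w = fpChartWeight β H r` obeys
* **`setIntegral_diff_le`** (NUMERATOR): `∫_{chartDomain ∖ smallField s} w ≤ K·D₀·((2π²)⁻¹)^n · 6n·e^{−β(1−ε)s²/(3C₃)} · ∫ e^{−β(1−ε)Q}` when `T = π·r`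
  (support localisation ✓`EdgeChart.fpChartWeight_eq_zero_of_not_smallField`, pointwise sandwich ✓`FPChart.fpChartWeight_le_of_sandwich`, relative tail
  ✓`ChartGauss.setIntegral_compl_smallField_exp_le`);
* **`le_setIntegral_smallField`** (DENOMINATOR): `K⁻¹·D₀·((2π²)⁻¹)^n·e^{−n(t²/3+t⁴)} · (1 − 6n·e^{−β(1+ε)t²/(3C₃)}) · ∫ e^{−β(1+ε)Q} ≤ ∫_{smallField t} w` for
  `0 ≤ t ≤ min(T, r, 1)` (✓`FPChart.le_fpChartWeight_of_sandwich`, ✓`ChartGauss.le_setIntegral_smallField_exp`; integrability of `w` on the bounded box from the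
  uniform bound `w ≤ K·D₀·((2π²)⁻¹)^n`);
plus hygiene: `card_landauFree_le` (`|LandauFree H| ≤ 216·H⁴`), `measurableSet_chartDomain`, `volume_smallField_lt_top`, `fpChartWeight_le_const`,
`integrableOn_fpChartWeight_smallField`.  The packaging into `SmallFieldInsideFP` (constants, `T = πr`, `t = s/2`, the mass ratio
✓`ChartGauss.integral_exp_neg_mul_boxQuadForm_eq_mul`) is the companion file.

Everything proved; no definitions; standard axioms.  HONEST LABEL: inputs of the OPEN task T-S5.6 of STEP 2 of the XL stub S5 of a critic-PASSed DRAFT line on the R2ξ″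
cruxes; T-S5.6, S5, U5 and the items ⟨24004⟩ ⟨24335⟩ ⟨24336⟩ remain OPEN; no stub is closed by name, no crux, rung or summit is proved; the Yang–Mills mass gap is
NOT proved by this file.
-/

set_option autoImplicit false

open MeasureTheory Real Finset
open Literature.MathematicalPhysics.QuantumFieldTheory.AxialGauge (boxEdges)

namespace Summit.QuantumFields.YangMills.Theorems.AllWindowsColdBoxBoxHighLine

namespace SmallFieldFP

variable {H : ℕ}

/-! ## Hygiene: cardinality, measurability, finiteness, integrability -/

/-- `|LandauFree H| = #boxEdges 4 (2H+1) = 8H(2H+1)³ ≤ 216·H⁴` (`H ≥ 1`). -/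
theorem card_landauFree_le (hH : 1 ≤ H) : (Fintype.card (LandauFree H) : ℝ) ≤ 216 * (H : ℝ) ^ 4 := by
  have hc : Fintype.card (LandauFree H) = (boxEdges 4 (2 * H + 1)).card := by
    rw [← Fintype.card_congr (EdgeChart.freeEquiv H), Fintype.card_coe]
  rw [hc, Literature.MathematicalPhysics.QuantumFieldTheory.AxialGauge.card_boxEdges]
  have h : 4 * ((2 * H + 1 - 1) * (2 * H + 1) ^ (4 - 1)) ≤ 216 * H ^ 4 := by
    have h1 : 2 * H + 1 ≤ 3 * H := by omega
    calc 4 * ((2 * H + 1 - 1) * (2 * H + 1) ^ (4 - 1)) = 8 * H * (2 * H + 1) ^ 3 := by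
          rw [show 2 * H + 1 - 1 = 2 * H by omega]; ring
      _ ≤ 8 * H * (3 * H) ^ 3 := by gcongr
      _ = 216 * H ^ 4 := by ring
  exact_mod_cast h

/-- The chart domain is open, hence measurable. -/
theorem measurableSet_chartDomain : MeasurableSet (chartDomain H) := by
  have h : chartDomain H = ⋂ e : LandauFree H, {a : LandauFree H → E3 | ‖a e‖ < Real.pi} := by
    ext a; simp [chartDomain]
  rw [h]
  refine (isOpen_iInter_of_finite fun e => ?_).measurableSet
  exact isOpen_lt ((continuous_apply e).norm) continuous_const

/-- The small-field box is the closed sup-ball, so it has finite volume. -/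
theorem volume_smallField_lt_top {t : ℝ} (ht : 0 ≤ t) : volume (smallField H t) < ⊤ := by
  have h : smallField H t ⊆ Metric.closedBall (0 : LandauFree H → E3) t := by
    intro a ha
    rw [mem_closedBall_zero_iff, pi_norm_le_iff_of_nonneg ht]
    exact ha
  exact lt_of_le_of_lt (measure_mono h) measure_closedBall_lt_top

/-- A uniform bound on the chart weight on `smallField H T` from the sandwich and the determinant comparison: `w ≤ K·D₀·((2π²)⁻¹)^n` (`β ≥ 0`, `ε ≤ 1`). -/
theorem fpChartWeight_le_const (hH : 1 ≤ H) {β T ε K D₀ : ℝ} (hβ : 0 ≤ β) (hε : ε ≤ 1) (hK : 0 ≤ K) (hD₀ : 0 ≤ D₀)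
    (hsand : ∀ a : LandauFree H → E3, (∀ e, ‖a e‖ ≤ T) →
      |boxWilson H (edgeChart H a) + landauPhi H (edgeChart H a) - boxQuadForm H a| ≤ ε * boxQuadForm H a)
    (hdet : ∀ a : LandauFree H → E3, a ∈ smallField H T → |(fpOperator H (edgeChart H a)).det| ≤ K * D₀)
    (r : ℝ) {a : LandauFree H → E3} (ha : a ∈ smallField H T) :
    fpChartWeight β H r a ≤ K * D₀ * (1 / (2 * Real.pi ^ 2)) ^ Fintype.card (LandauFree H) := by
  have h := FPChart.fpChartWeight_le_of_sandwich hβ hsand r ha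
  have hQ := BoxQuadForm.boxQuadForm_nonneg hH a
  have hexp : Real.exp (-(β * (1 - ε) * boxQuadForm H a)) ≤ 1 := by
    rw [Real.exp_le_one_iff]
    have : 0 ≤ β * (1 - ε) * boxQuadForm H a := mul_nonneg (mul_nonneg hβ (by linarith)) hQ
    linarith
  have hpow : 0 ≤ (1 / (2 * Real.pi ^ 2)) ^ Fintype.card (LandauFree H) := by positivity
  calc fpChartWeight β H r a ≤ |(fpOperator H (edgeChart H a)).det| * (1 / (2 * Real.pi ^ 2)) ^ Fintype.card (LandauFree H) *
        Real.exp (-(β * (1 - ε) * boxQuadForm H a)) := h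
    _ ≤ (K * D₀) * (1 / (2 * Real.pi ^ 2)) ^ Fintype.card (LandauFree H) * 1 :=
        mul_le_mul (mul_le_mul_of_nonneg_right (hdet a ha) hpow) hexp (Real.exp_pos _).le
          (mul_nonneg (mul_nonneg hK hD₀) hpow)
    _ = K * D₀ * (1 / (2 * Real.pi ^ 2)) ^ Fintype.card (LandauFree H) := mul_one _

/-- The chart weight is integrable on every small-field box inside the sandwich level (bounded, measurable, finite volume). -/
theorem integrableOn_fpChartWeight_smallField (hH : 1 ≤ H) {β T ε K D₀ t : ℝ} (hβ : 0 ≤ β) (hε : ε ≤ 1) (hK : 0 ≤ K) (hD₀ : 0 ≤ D₀)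
    (hsand : ∀ a : LandauFree H → E3, (∀ e, ‖a e‖ ≤ T) →
      |boxWilson H (edgeChart H a) + landauPhi H (edgeChart H a) - boxQuadForm H a| ≤ ε * boxQuadForm H a)
    (hdet : ∀ a : LandauFree H → E3, a ∈ smallField H T → |(fpOperator H (edgeChart H a)).det| ≤ K * D₀)
    (r : ℝ) (ht : 0 ≤ t) (htT : t ≤ T) :
    IntegrableOn (fpChartWeight β H r) (smallField H t) := by
  refine Measure.integrableOn_of_bounded (M := K * D₀ * (1 / (2 * Real.pi ^ 2)) ^ Fintype.card (LandauFree H))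
    (volume_smallField_lt_top ht).ne (FPChart.measurable_fpChartWeight β H r).aestronglyMeasurable ?_
  refine (ae_restrict_iff' (ChartGauss.measurableSet_smallField t)).2 (ae_of_all _ fun a ha => ?_)
  have haT : a ∈ smallField H T := fun e => (ha e).trans htT
  rw [Real.norm_of_nonneg (FPChart.fpChartWeight_nonneg β r a)]
  exact fpChartWeight_le_const hH hβ hε hK hD₀ hsand hdet r haT

/-! ## The numerator: the integral over `chartDomain ∖ smallField s` -/

/-- **NUMERATOR.**  With the sandwich and the determinant bound at the support level `T = π·r` (`0 ≤ ε ≤ 1/2`, `β > 0`):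
`∫_{chartDomain ∖ smallField s} w ≤ K·D₀·((2π²)⁻¹)^n · (6n·e^{−β(1−ε)s²/(3C₃)} · ∫ e^{−β(1−ε)Q})`. -/
theorem setIntegral_diff_le {β r s ε K D₀ C₃ : ℝ} (hβ : 0 < β) (hr : 0 ≤ r) (hs : 0 ≤ s) (hε : ε ≤ 1 / 2)
    (hK : 0 ≤ K) (hD₀ : 0 ≤ D₀) (hC₃ : 0 < C₃) (hvar : ∀ e : LandauFree H, (hodgeQ H)⁻¹ e e ≤ C₃)
    (hsand : ∀ a : LandauFree H → E3, (∀ e, ‖a e‖ ≤ Real.pi * r) →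
      |boxWilson H (edgeChart H a) + landauPhi H (edgeChart H a) - boxQuadForm H a| ≤ ε * boxQuadForm H a)
    (hdet : ∀ a : LandauFree H → E3, a ∈ smallField H (Real.pi * r) → |(fpOperator H (edgeChart H a)).det| ≤ K * D₀) :
    ∫ a in chartDomain H \ smallField H s, fpChartWeight β H r a ≤
      K * D₀ * (1 / (2 * Real.pi ^ 2)) ^ Fintype.card (LandauFree H) *
        (6 * Fintype.card (LandauFree H) * Real.exp (-(β * (1 - ε) * s ^ 2 / (3 * C₃))) *
          ∫ a : LandauFree H → E3, Real.exp (-(β * (1 - ε) * boxQuadForm H a))) := by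
  have hβ' : 0 < β * (1 - ε) := mul_pos hβ (by linarith)
  have hpow : 0 ≤ (1 / (2 * Real.pi ^ 2)) ^ Fintype.card (LandauFree H) := by positivity
  have hM : 0 ≤ K * D₀ * (1 / (2 * Real.pi ^ 2)) ^ Fintype.card (LandauFree H) := mul_nonneg (mul_nonneg hK hD₀) hpow
  have hS : MeasurableSet (chartDomain H \ smallField H s) := measurableSet_chartDomain.diff (ChartGauss.measurableSet_smallField s)
  -- pointwise domination of the indicator
  have hptw : ∀ a : LandauFree H → E3, (chartDomain H \ smallField H s).indicator (fpChartWeight β H r) a ≤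
      K * D₀ * (1 / (2 * Real.pi ^ 2)) ^ Fintype.card (LandauFree H) *
        (smallField H s)ᶜ.indicator (fun a => Real.exp (-(β * (1 - ε) * boxQuadForm H a))) a := by
    intro a
    by_cases ha : a ∈ chartDomain H \ smallField H s
    · have hac : a ∈ (smallField H s)ᶜ := ha.2
      rw [Set.indicator_of_mem ha, Set.indicator_of_mem hac]
      by_cases hb : a ∈ smallField H (Real.pi * r)
      · calc fpChartWeight β H r a ≤ |(fpOperator H (edgeChart H a)).det| * (1 / (2 * Real.pi ^ 2)) ^ Fintype.card (LandauFree H) *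
              Real.exp (-(β * (1 - ε) * boxQuadForm H a)) := FPChart.fpChartWeight_le_of_sandwich hβ.le hsand r hb
          _ ≤ K * D₀ * (1 / (2 * Real.pi ^ 2)) ^ Fintype.card (LandauFree H) * Real.exp (-(β * (1 - ε) * boxQuadForm H a)) :=
              mul_le_mul_of_nonneg_right (mul_le_mul_of_nonneg_right (hdet a hb) hpow) (Real.exp_pos _).le
      · rw [EdgeChart.fpChartWeight_eq_zero_of_not_smallField β hr ha.1 hb]
        exact mul_nonneg hM (Real.exp_pos _).le
    · rw [Set.indicator_of_notMem ha]
      exact mul_nonneg hM (Set.indicator_nonneg (fun _ _ => (Real.exp_pos _).le) _)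
  -- integrate
  have hgi := ChartGauss.integrable_exp_neg_mul_boxQuadForm (H := H) hβ'
  have hupper : Integrable fun a : LandauFree H → E3 => K * D₀ * (1 / (2 * Real.pi ^ 2)) ^ Fintype.card (LandauFree H) *
      (smallField H s)ᶜ.indicator (fun a => Real.exp (-(β * (1 - ε) * boxQuadForm H a))) a :=
    (hgi.indicator (ChartGauss.measurableSet_smallField s).compl).const_mul _
  rw [← integral_indicator hS]
  calc ∫ a, (chartDomain H \ smallField H s).indicator (fpChartWeight β H r) a
      ≤ ∫ a, K * D₀ * (1 / (2 * Real.pi ^ 2)) ^ Fintype.card (LandauFree H) *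
          (smallField H s)ᶜ.indicator (fun a => Real.exp (-(β * (1 - ε) * boxQuadForm H a))) a :=
        integral_mono_of_nonneg (ae_of_all _ fun a => Set.indicator_nonneg (fun _ _ => FPChart.fpChartWeight_nonneg β r _) _)
          hupper (ae_of_all _ hptw)
    _ = K * D₀ * (1 / (2 * Real.pi ^ 2)) ^ Fintype.card (LandauFree H) *
          ∫ a in (smallField H s)ᶜ, Real.exp (-(β * (1 - ε) * boxQuadForm H a)) := by
        rw [integral_const_mul, integral_indicator (ChartGauss.measurableSet_smallField s).compl]
    _ ≤ K * D₀ * (1 / (2 * Real.pi ^ 2)) ^ Fintype.card (LandauFree H) *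
          (6 * Fintype.card (LandauFree H) * Real.exp (-(β * (1 - ε) * s ^ 2 / (3 * C₃))) *
            ∫ a : LandauFree H → E3, Real.exp (-(β * (1 - ε) * boxQuadForm H a))) :=
        mul_le_mul_of_nonneg_left (ChartGauss.setIntegral_compl_smallField_exp_le hβ' hs hC₃ hvar) hM

/-! ## The denominator: the integral over `smallField t` from below -/

/-- **DENOMINATOR.**  With the sandwich at level `T`, the two-sided determinant comparison on `smallField H T`, `0 < r`, `0 ≤ t ≤ min(T, r, 1)`, `0 ≤ ε ≤ 1`, `K > 0`:
`K⁻¹·D₀·((2π²)⁻¹)^n·e^{−n(t²/3+t⁴)} · ((1 − 6n·e^{−β(1+ε)t²/(3C₃)})·∫ e^{−β(1+ε)Q}) ≤ ∫_{smallField t} w`. -/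
theorem le_setIntegral_smallField (hH : 1 ≤ H) {β r t T ε K D₀ C₃ : ℝ} (hβ : 0 < β) (hr : 0 < r) (ht0 : 0 ≤ t) (htr : t ≤ r) (ht1 : t ≤ 1)
    (htT : t ≤ T) (hε0 : 0 ≤ ε) (hε1 : ε ≤ 1) (hK : 0 < K) (hD₀ : 0 ≤ D₀) (hC₃ : 0 < C₃)
    (hvar : ∀ e : LandauFree H, (hodgeQ H)⁻¹ e e ≤ C₃)
    (hsand : ∀ a : LandauFree H → E3, (∀ e, ‖a e‖ ≤ T) →
      |boxWilson H (edgeChart H a) + landauPhi H (edgeChart H a) - boxQuadForm H a| ≤ ε * boxQuadForm H a)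
    (hdet : ∀ a : LandauFree H → E3, a ∈ smallField H T →
      |(fpOperator H (edgeChart H a)).det| ≤ K * D₀ ∧ D₀ ≤ K * |(fpOperator H (edgeChart H a)).det|) :
    K⁻¹ * D₀ * ((1 / (2 * Real.pi ^ 2)) ^ Fintype.card (LandauFree H) * Real.exp (-(Fintype.card (LandauFree H) * (t ^ 2 / 3 + t ^ 4)))) *
        ((1 - 6 * Fintype.card (LandauFree H) * Real.exp (-(β * (1 + ε) * t ^ 2 / (3 * C₃)))) *
          ∫ a : LandauFree H → E3, Real.exp (-(β * (1 + ε) * boxQuadForm H a))) ≤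
      ∫ a in smallField H t, fpChartWeight β H r a := by
  have hβ' : 0 < β * (1 + ε) := mul_pos hβ (by linarith)
  have hsand_t : ∀ a : LandauFree H → E3, (∀ e, ‖a e‖ ≤ t) →
      |boxWilson H (edgeChart H a) + landauPhi H (edgeChart H a) - boxQuadForm H a| ≤ ε * boxQuadForm H a :=
    fun a ha => hsand a fun e => (ha e).trans htT
  set c : ℝ := K⁻¹ * D₀ * ((1 / (2 * Real.pi ^ 2)) ^ Fintype.card (LandauFree H) *
    Real.exp (-(Fintype.card (LandauFree H) * (t ^ 2 / 3 + t ^ 4)))) with hc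
  have hc0 : 0 ≤ c := by rw [hc]; positivity
  -- pointwise on the box
  have hptw : ∀ a ∈ smallField H t, c * Real.exp (-(β * (1 + ε) * boxQuadForm H a)) ≤ fpChartWeight β H r a := by
    intro a ha
    have haT : a ∈ smallField H T := fun e => (ha e).trans htT
    have hD : K⁻¹ * D₀ ≤ |(fpOperator H (edgeChart H a)).det| := by
      rw [inv_mul_le_iff₀ hK]
      exact (hdet a haT).2
    have h := FPChart.le_fpChartWeight_of_sandwich hβ.le hr.ne' ht0 htr ht1 hsand_t ha
    refine le_trans ?_ h
    rw [hc]
    have hh : 0 ≤ (1 / (2 * Real.pi ^ 2)) ^ Fintype.card (LandauFree H) * Real.exp (-(Fintype.card (LandauFree H) * (t ^ 2 / 3 + t ^ 4))) := by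
      positivity
    exact mul_le_mul_of_nonneg_right (mul_le_mul_of_nonneg_right hD hh) (Real.exp_pos _).le
  -- integrate over the box
  have hgi := ChartGauss.integrable_exp_neg_mul_boxQuadForm (H := H) hβ'
  have hwi : IntegrableOn (fpChartWeight β H r) (smallField H t) :=
    integrableOn_fpChartWeight_smallField hH hβ.le hε1 hK.le hD₀ hsand (fun a ha => (hdet a ha).1) r ht0 htT
  calc c * ((1 - 6 * Fintype.card (LandauFree H) * Real.exp (-(β * (1 + ε) * t ^ 2 / (3 * C₃)))) *
          ∫ a : LandauFree H → E3, Real.exp (-(β * (1 + ε) * boxQuadForm H a)))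
      ≤ c * ∫ a in smallField H t, Real.exp (-(β * (1 + ε) * boxQuadForm H a)) :=
        mul_le_mul_of_nonneg_left (ChartGauss.le_setIntegral_smallField_exp hβ' ht0 hC₃ hvar) hc0
    _ = ∫ a in smallField H t, c * Real.exp (-(β * (1 + ε) * boxQuadForm H a)) := (integral_const_mul _ _).symm
    _ ≤ ∫ a in smallField H t, fpChartWeight β H r a :=
        setIntegral_mono_on (hgi.integrableOn.const_mul c) hwi (ChartGauss.measurableSet_smallField t) hptw

end SmallFieldFP

end Summit.QuantumFields.YangMills.Theorems.AllWindowsColdBoxBoxHighLine
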